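import Summits.QuantumAdvantage.AdviceFreeQNC0.FibreDecimation37Identity
import Summits.QuantumAdvantage.AdviceFreeQNC0.FibreDecimation37Glue
import Summits.QuantumAdvantage.AdviceFreeQNC0.FibreDecimation37ParityCount
import HarnessLib

/-!
# Cell qa-qnc0, `p = 3` — ROUND-37P2 File B, Theorem 37.F′ fibre by fibre: STEP 2 (decimate) on one `y`-fibre and the
# hypotheses of STEP 3′ from (NH)

Planner qa-qnc0-p2 g37, ROUND-37P2 §2, proof of Theorem 37.F′, the per-fibre part.  Typed setting of `FibreNonExact37NH`
(`FibreDecimation37.lean`): coins `Fin z`, chosen coins `ι : Fin m ↪ Fin z` carrying the letters `a` of the dense test `k₀`,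
tests `(β_k, r_k)`, affine target `u ↦ μ₀ + #{c ∈ S : u_c}`, coset parity `ε`.  For an outside assignment `y ∈ {0,1}^Y`
(`Out ι → Bool`) the residues are `ρ_k(y) = ⟨β_k|_Y, y⟩ − r_k` (`rho`), the `M`-part of the target is `T = {i : ι i ∈ S}`
(`tgtM`), its `Y`-part the bit `b(y) = μ₀ + #{c ∈ S ∩ Y : y_c}` (`bOutN`, `bOut`).

* `card_test_glue`, `affTarget_glue`, `gfun_glue_eq_natCast`, `gfun_eq_zero_of_agree` — at the glued point `u = (w,y)` the
  agreement `f(u) ≡ λ(u)` says exactly that the fibre function `g_{ρ(y),b(y)}(w)` (`Exp37.gfun`) vanishes;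
* `gfun_mul_cosetInd_eq_zero_of_good` — a GOOD even `y` (every point of `H_ε` above `y` agrees) has `g·1_{H_ε(M)} ≡ 0`;
* `good_fibre_parity` — hence, by the decimation identity (`decimation_identity`), the decoded tests satisfy the parity
  relation `#{k : ⟨β_k|_Y,y⟩ ∈ Acc_k} ≡ c⋆ (mod 2)` with `Acc_k = {v : ψ_k(v − r_k) = 1}` (`accSet`), `c⋆ = tr(θC)` (`cStar`);
* `accSet_eq_empty_of_not_mem_decimSet` (tests off `J` are trivial), `accSet_pattern_genuine` (`k₀` is genuine, `m` odd,
  `m ≥ 2`), `wt_combo_dirOut` / `nh_weight_sum_le` ((NH) is the weight hypothesis of `card_parityClass_filter_le`).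

WHAT THIS IS NOT: the final count (STEP 1 + assembly) is `FibreDecimation37NH.lean`; crux 22907 untouched; no separation.
-/

noncomputable section

namespace Summit.QuantumAdvantage.AdviceFreeQNC0.Exp37

open Finset
open Summit.QuantumAdvantage.AdviceFreeQNC0 F4
open Literature.Computability.MetaComplexity Literature.Computability.MetaComplexity.ModTestProduct

variable {z s m : ℕ}

/-! ### Fibre data -/

/-- The outside part `β_k|_Y` of a direction. -/
def dirOut (ι : Fin m ↪ Fin z) (β : Fin s → Fin z → ZMod 3) (k : Fin s) (c : Out ι) : ZMod 3 := β k c.1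

/-- The residue `ρ_k(y) = ⟨β_k|_Y, y⟩ − r_k`. -/
def rho (ι : Fin m ↪ Fin z) (β : Fin s → Fin z → ZMod 3) (r : Fin s → ZMod 3) (k : Fin s) (y : Out ι → Bool) :
    ZMod 3 :=
  subsetSum (dirOut ι β k) y - r k

/-- The `M`-part `T = {i : ι i ∈ S}` of the affine target. -/
def tgtM (ι : Fin m ↪ Fin z) (S : Finset (Fin z)) : Finset (Fin m) := univ.filter fun i => ι i ∈ S

/-- The `Y`-part of the affine target at `y`, as a natural number: `μ₀ + #{c ∈ Y ∩ S : y_c}`. -/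
def bOutN (ι : Fin m ↪ Fin z) (μ₀ : ℕ) (S : Finset (Fin z)) (y : Out ι → Bool) : ℕ :=
  μ₀ + (univ.filter fun c : Out ι => y c = true ∧ c.1 ∈ S).card

/-- The `Y`-part of the affine target at `y`, as a bit of `𝔽₄`. -/
def bOut (ι : Fin m ↪ Fin z) (μ₀ : ℕ) (S : Finset (Fin z)) (y : Out ι → Bool) : F4 :=
  if bOutN ι μ₀ S y % 2 = 1 then 1 else 0

open Classical in
/-- The accepting set of the decoded test `k`: `Acc_k = {v : ψ_k(v − r_k) = 1}`. -/
def accSet (ι : Fin m ↪ Fin z) (β : Fin s → Fin z → ZMod 3) (r : Fin s → ZMod 3) (a : Fin m → Bool) (ε : ℕ)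
    (k : Fin s) : Finset (ZMod 3) :=
  univ.filter fun v =>
    psi (theta a ε) (coefA a ε (restrictM ι β k)) (coefA a ε (-restrictM ι β k)) (v - r k) = 1

open Classical in
/-- The target parity `c⋆ ∈ {0,1}` of the decimated relation (`tr(θ C)` read as a natural number). -/
def cStar (ι : Fin m ↪ Fin z) (a : Fin m → Bool) (ε : ℕ) (S : Finset (Fin z)) : ℕ :=
  if tr (theta a ε * coefC a ε (tgtM ι S)) = 1 then 1 else 0

/-! ### The glued point: agreement says the fibre function vanishes -/

/-- The linear form of test `k` splits at a glued point: `⟨β_k, u⟩ = ⟨β_k|_M, w⟩ + ⟨β_k|_Y, y⟩`. -/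
theorem form_glue (ι : Fin m ↪ Fin z) (β : Fin s → Fin z → ZMod 3) (k : Fin s) (w : Fin m → Bool)
    (y : Out ι → Bool) :
    (∑ c, if glue ι w y c then β k c else 0) = dotM (restrictM ι β k) w + subsetSum (dirOut ι β k) y := by
  rw [sum_split_glue ι w y (fun c b => if b then β k c else 0)]
  rfl

/-- The firing tests at a glued point are `{k : ⟨β_k|_M, w⟩ + ρ_k(y) ≢ 0}`. -/
theorem card_test_glue (ι : Fin m ↪ Fin z) (β : Fin s → Fin z → ZMod 3) (r : Fin s → ZMod 3) (w : Fin m → Bool)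
    (y : Out ι → Bool) :
    (univ.filter fun k => test β r k (glue ι w y) = true).card =
      (univ.filter fun k => dotM (restrictM ι β k) w + rho ι β r k y ≠ 0).card := by
  refine congrArg Finset.card (filter_congr fun k _ => ?_)
  unfold test rho
  rw [decide_eq_true_iff, form_glue, ← sub_ne_zero, add_sub_assoc]

/-- The affine target at a glued point: `λ(u) = #{i ∈ T : w_i} + b(y)`. -/
theorem affTarget_glue (ι : Fin m ↪ Fin z) (μ₀ : ℕ) (S : Finset (Fin z)) (w : Fin m → Bool) (y : Out ι → Bool) :
    affTarget μ₀ S (glue ι w y) = ((tgtM ι S).filter fun i => w i = true).card + bOutN ι μ₀ S y := by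
  unfold affTarget bOutN
  have e : (S.filter fun c => glue ι w y c = true) = univ.filter fun c => glue ι w y c = true ∧ c ∈ S := by
    ext c; simp [and_comm]
  have eT : ((tgtM ι S).filter fun i => w i = true) = univ.filter fun i : Fin m => w i = true ∧ ι i ∈ S := by
    ext i; simp [tgtM, and_comm]
  rw [e, eT, card_filter_glue ι w y (fun c => c ∈ S)]
  ring

/-- **The fibre function at a glued point is a parity count**:
`g_{ρ(y), b(y)}(w) = #{firing tests} + #{i ∈ T : w_i} + b(y)` (cast into `𝔽₄`). -/
theorem gfun_glue_eq_natCast (ι : Fin m ↪ Fin z) (β : Fin s → Fin z → ZMod 3) (r : Fin s → ZMod 3) (μ₀ : ℕ)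
    (S : Finset (Fin z)) (w : Fin m → Bool) (y : Out ι → Bool) :
    gfun (restrictM ι β) (tgtM ι S) (fun k => rho ι β r k y) (bOut ι μ₀ S y) w =
      (((univ.filter fun k => dotM (restrictM ι β k) w + rho ι β r k y ≠ 0).card +
        ((tgtM ι S).filter fun i => w i = true).card + bOutN ι μ₀ S y : ℕ) : F4) := by
  classical
  unfold gfun testF bOut
  beta_reduce
  have h1 : (∑ k : Fin s, (if dotM (restrictM ι β k) w + rho ι β r k y ≠ 0 then (1 : F4) else 0)) =
      ((univ.filter fun k => dotM (restrictM ι β k) w + rho ι β r k y ≠ 0).card : F4) := Finset.sum_boole _ _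
  have h2 : (∑ i ∈ tgtM ι S, ιF (w i)) = (((tgtM ι S).filter fun i => w i = true).card : F4) := by
    unfold ιF; exact Finset.sum_boole _ _
  rw [h1, h2, ← natCast_eq]
  push_cast
  ring

/-- **Agreement ⇒ the fibre function vanishes** at the glued point. -/
theorem gfun_eq_zero_of_agree (ι : Fin m ↪ Fin z) (β : Fin s → Fin z → ZMod 3) (r : Fin s → ZMod 3) (μ₀ : ℕ)
    (S : Finset (Fin z)) (w : Fin m → Bool) (y : Out ι → Bool)
    (hagree : testParity β r (glue ι w y) % 2 = affTarget μ₀ S (glue ι w y) % 2) :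
    gfun (restrictM ι β) (tgtM ι S) (fun k => rho ι β r k y) (bOut ι μ₀ S y) w = 0 := by
  rw [gfun_glue_eq_natCast, natCast_eq, if_neg]
  unfold testParity at hagree
  rw [card_test_glue, affTarget_glue] at hagree
  omega

/-- **A good even fibre has `g·1_{H_ε(M)} ≡ 0`**: if every point of `H_ε` above `y` (`|y|` even) agrees with the
target, then `g_{ρ(y),b(y)}(w)·1_{H_ε}(w) = 0` for all `w`. -/
theorem gfun_mul_cosetInd_eq_zero_of_good (ι : Fin m ↪ Fin z) (β : Fin s → Fin z → ZMod 3) (r : Fin s → ZMod 3)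
    (μ₀ ε : ℕ) (S : Finset (Fin z)) (y : Out ι → Bool) (hy : (univ.filter fun c => y c = true).card % 2 = 0)
    (hgood : ∀ u ∈ coset z ε, (fun c : Out ι => u c.1) = y →
      testParity β r u % 2 = affTarget μ₀ S u % 2) (w : Fin m → Bool) :
    gfun (restrictM ι β) (tgtM ι S) (fun k => rho ι β r k y) (bOut ι μ₀ S y) w * cosetInd ε w = 0 := by
  unfold cosetInd
  split_ifs with hw
  · rw [mul_one]
    refine gfun_eq_zero_of_agree ι β r μ₀ S w y (hgood _ ?_ (out_glue ι w y))
    unfold coset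
    rw [mem_filter, card_true_glue]
    exact ⟨mem_univ _, by omega⟩
  · rw [mul_zero]

/-! ### STEP 2 on a good fibre: the decoded parity relation -/

open Classical in
/-- Each decoded test value is `0` or `1`; as a summand it is the indicator of `ψ = 1`. -/
theorem psi_eq_ite (θ A B : F4) (t : ZMod 3) : psi θ A B t = if psi θ A B t = 1 then 1 else 0 := by
  rcases psi_cases θ A B t with h | h
  · rw [h, if_neg]; exact fun h' => one_ne_zero' h'.symm
  · rw [h, if_pos rfl]

/-- **STEP 2 (decimate) on a good even fibre**: `#{k : ⟨β_k|_Y, y⟩ ∈ Acc_k} ≡ c⋆ (mod 2)`. -/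
theorem good_fibre_parity (ι : Fin m ↪ Fin z) (β : Fin s → Fin z → ZMod 3) (r : Fin s → ZMod 3) (a : Fin m → Bool)
    (μ₀ ε : ℕ) (S : Finset (Fin z)) (hm : Odd m) (y : Out ι → Bool)
    (hy : (univ.filter fun c => y c = true).card % 2 = 0)
    (hgood : ∀ u ∈ coset z ε, (fun c : Out ι => u c.1) = y →
      testParity β r u % 2 = affTarget μ₀ S u % 2) :
    (univ.filter fun k => subsetSum (dirOut ι β k) y ∈ accSet ι β r a ε k).card % 2 = cStar ι a ε S % 2 := by
  classical
  have hb : bOut ι μ₀ S y = 0 ∨ bOut ι μ₀ S y = 1 := by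
    unfold bOut; split_ifs
    · exact Or.inr rfl
    · exact Or.inl rfl
  have hid := decimation_identity a ε (restrictM ι β) (tgtM ι S) (theta_mul_coefU a ε hm)
    (fun k => rho ι β r k y) hb (gfun_mul_cosetInd_eq_zero_of_good ι β r μ₀ ε S y hy hgood)
  -- the left side is the cast of the count
  have hcount : (∑ k, psi (theta a ε) (coefA a ε (restrictM ι β k)) (coefA a ε (-restrictM ι β k)) (rho ι β r k y)) =
      ((univ.filter fun k => subsetSum (dirOut ι β k) y ∈ accSet ι β r a ε k).card : F4) := by
    rw [Finset.sum_congr rfl fun k _ => psi_eq_ite _ _ _ _, Finset.sum_boole]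
    congr 2
    refine filter_congr fun k _ => ?_
    unfold accSet rho
    rw [mem_filter]
    simp
  rw [hcount, natCast_eq] at hid
  unfold cStar
  rcases tr_cases (theta a ε * coefC a ε (tgtM ι S)) with h0 | h1
  · rw [h0] at hid ⊢
    rw [if_neg (fun h => one_ne_zero' h.symm)]
    by_contra hne
    rw [if_pos (by omega)] at hid
    exact one_ne_zero' hid
  · rw [h1] at hid ⊢
    rw [if_pos rfl]
    by_contra hne
    rw [if_neg (by omega)] at hid
    exact one_ne_zero' hid.symm

/-! ### The hypotheses of STEP 3′ -/

/-- Membership in the decimated set. -/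
theorem mem_decimSet_iff (ι : Fin m ↪ Fin z) (a : Fin m → Bool) (β : Fin s → Fin z → ZMod 3) (k : Fin s) :
    k ∈ decimSet ι a β ↔ JCond a (restrictM ι β k) := by
  unfold decimSet
  simp

/-- **Tests off the decimated set are trivial**: `Acc_k = ∅` for `k ∉ J`. -/
theorem accSet_eq_empty_of_not_mem_decimSet (ι : Fin m ↪ Fin z) (β : Fin s → Fin z → ZMod 3) (r : Fin s → ZMod 3)
    (a : Fin m → Bool) (ε : ℕ) (hm : Odd m) (k : Fin s) (hk : k ∉ decimSet ι a β) :
    accSet ι β r a ε k = ∅ := by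
  rw [mem_decimSet_iff] at hk
  unfold accSet
  refine filter_eq_empty_iff.2 fun v _ => ?_
  rw [psi_eq_zero_of_not_JCond a ε hm hk]
  exact fun h => one_ne_zero' h.symm

/-- **The dense test is genuine**: `∅ ≠ Acc_{k₀} ≠ ℤ/3` (`m` odd, `m ≥ 2`). -/
theorem accSet_pattern_genuine (ι : Fin m ↪ Fin z) (β : Fin s → Fin z → ZMod 3) (r : Fin s → ZMod 3)
    (a : Fin m → Bool) (ε : ℕ) (hm : Odd m) (h2 : 2 ≤ m) (k₀ : Fin s) (hβ : ∀ i, β k₀ (ι i) = lettZ (a i)) :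
    (accSet ι β r a ε k₀).Nonempty ∧ accSet ι β r a ε k₀ ≠ univ := by
  have hδ : restrictM ι β k₀ = fun i => lettZ (a i) := funext hβ
  obtain ⟨t, t', htt⟩ := psi_pattern_nonconst a ε hm h2
  -- membership of `t + r_{k₀}` in `Acc_{k₀}` is `ψ(t) = 1`
  have hmem : ∀ τ : ZMod 3, τ + r k₀ ∈ accSet ι β r a ε k₀ ↔
      psi (theta a ε) (coefA a ε (fun i => lettZ (a i))) (coefA a ε (-fun i => lettZ (a i))) τ = 1 := by
    intro τ
    unfold accSet
    rw [mem_filter, hδ, add_sub_cancel_right]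
    simp
  rcases psi_cases (theta a ε) (coefA a ε (fun i => lettZ (a i))) (coefA a ε (-fun i => lettZ (a i))) t with ht | ht <;>
    rcases psi_cases (theta a ε) (coefA a ε (fun i => lettZ (a i))) (coefA a ε (-fun i => lettZ (a i))) t'
      with ht' | ht'
  · exact absurd (ht.trans ht'.symm) htt
  · refine ⟨⟨t' + r k₀, (hmem t').2 ht'⟩, fun hu => ?_⟩
    have h := (hmem t).1 (by rw [hu]; exact mem_univ _)
    rw [ht] at h; exact one_ne_zero' h.symm
  · refine ⟨⟨t + r k₀, (hmem t).2 ht⟩, fun hu => ?_⟩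
    have h := (hmem t').1 (by rw [hu]; exact mem_univ _)
    rw [ht'] at h; exact one_ne_zero' h.symm
  · exact absurd (ht.trans ht'.symm) htt

/-- The weight of a combined outside form is the typed `weightY`. -/
theorem wt_combo_dirOut (ι : Fin m ↪ Fin z) (β : Fin s → Fin z → ZMod 3) (j : Fin s → ZMod 3) :
    ModTestProduct.wt (combo (dirOut ι β) j) = weightY ι β j := by
  classical
  unfold ModTestProduct.wt combo dirOut weightY
  exact card_filter_subtype ι (fun c => (∑ k, j k * β k c) ≠ 0)

/-- **(NH) is the weight hypothesis of STEP 3′** (outside-coin form; stated for any presentation `P` of the index set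
`{j ≠ 0 : supp j ⊆ J}` so that it applies verbatim to `card_parityClass_filter_le`). -/
theorem nh_weight_sum_le (ι : Fin m ↪ Fin z) (a : Fin m → Bool) (β : Fin s → Fin z → ZMod 3) (h : NHCond ι a β)
    (P : Finset (Fin s → ZMod 3)) (hP : ∀ j, j ∈ P ↔ (j ≠ 0 ∧ ∀ k, k ∉ decimSet ι a β → j k = 0)) :
    ∑ j ∈ P, ((3 : ℝ) / 4) ^ ModTestProduct.wt (combo (dirOut ι β) j) ≤ 1 / 50 := by
  classical
  obtain ⟨-, h2⟩ := h
  refine le_trans (le_of_eq ?_) h2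
  refine Finset.sum_congr ?_ fun j _ => by rw [wt_combo_dirOut]
  ext j
  rw [hP j]
  simp only [mem_filter, mem_univ, true_and]

end Summit.QuantumAdvantage.AdviceFreeQNC0.Exp37

end
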